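import Mathlib
import Literature.Analysis.FluidPDE.VectorCalculus

/-!
# Clause 13-J, brick B1: the SELF TERM of the linearised map on a STRAIGHT filament with CONSTANT core is the Taylor-remainder operator
# `∫ ((τ−σ)² + q)^{-3/2} • t × (Y τ − Y σ − (τ−σ)•Y′σ) dσ`

Route `FilamentSkeletonRss`, child 28296 `Clause13NearStraight` of `SkeletonJ1G` (stmt-27849); design memo
`filament-plan/DESIGN-28296-clause13-g12.md` §4 B1.  In `…Clause13LinearisedMap.deriv_linearisedMap_tangent` the self filament
`k = j` contributes `∫ D_j σ dσ` with the moving-point variation integrand `D_j`.  For the MODEL skeleton — a straight line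
`X σ = p + σ•t`, `‖t‖ = 1`, constant core `q` — and a NORMAL variation `Y` (`⟪Y σ, t⟫ = 0`), the first (kernel-derivative) part of
`D_j` vanishes identically (`⟪(τ−σ)t, Y τ − Y σ⟫ = 0`, `t × (τ−σ)t = 0`) and the rest collapses to
`((τ−σ)² + q)^{-3/2} • t × (Y τ − Y σ − (τ−σ)•Y′σ)` (`selfIntegrand_straight`), whence the integral identity
(`selfTerm_straight`).  Its Fourier multiplier is `(2/q)·𝔖(k√q)` (`liaSym`, landed) — bricks B2/B3 of the memo.
Lane ns-filament-19175-p1 g12; `--supports stmt-NavierStokesRegularity-28296 --as helper`.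
HONEST FRAMING: calculus for a HYPOTHETICAL filament skeleton on the NEGATIVE side of a MODEL route; nothing here bears on
Navier–Stokes regularity or blow-up.
-/

noncomputable section

open scoped InnerProductSpace
open MeasureTheory
open Literature.Analysis.FluidPDE

namespace Summit.NavierStokesRegularity.NavierStokesRegularity.Theorems.MatchedKernel
set_option linter.dupNamespace false

/-- The straight line `σ ↦ p + σ•t` has derivative `t`. [folklore] -/
theorem deriv_line (p t : EuclideanSpace ℝ (Fin 3)) (σ : ℝ) : deriv (fun σ : ℝ => p + σ • t) σ = t := by
  have : HasDerivAt (fun σ : ℝ => p + σ • t) t σ := by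
    simpa using ((hasDerivAt_id' (x := σ)).smul_const t).const_add p
  exact this.deriv

/-- **B1, pointwise.** On the straight constant-core model with a normal variation, the moving-point variation integrand of the
self filament equals the Taylor-remainder integrand `((τ−σ)²+q)^{-3/2} • t × (Y τ − Y σ − (τ−σ)•Y′σ)`. [folklore] -/
theorem selfIntegrand_straight (p t : EuclideanSpace ℝ (Fin 3)) (ht : ‖t‖ = 1) (q : ℝ) (Y : ℝ → EuclideanSpace ℝ (Fin 3))
    (hYn : ∀ σ, ⟪Y σ, t⟫_ℝ = 0) (τ σ : ℝ) :
    (-3 * ⟪(p + τ • t) - (p + σ • t), Y τ - Y σ⟫_ℝ *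
          ((‖(p + τ • t) - (p + σ • t)‖ ^ 2 + q) ^ (5 / 2 : ℝ))⁻¹) •
        cross (deriv (fun σ : ℝ => p + σ • t) σ) ((p + τ • t) - (p + σ • t)) +
      ((‖(p + τ • t) - (p + σ • t)‖ ^ 2 + q) ^ (3 / 2 : ℝ))⁻¹ •
        (cross (deriv (fun σ : ℝ => p + σ • t) σ) (Y τ - Y σ) + cross (deriv Y σ) ((p + τ • t) - (p + σ • t)))
    = (((τ - σ) ^ 2 + q) ^ (3 / 2 : ℝ))⁻¹ • cross t (Y τ - Y σ - (τ - σ) • deriv Y σ) := by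
  have hdiff : (p + τ • t) - (p + σ • t) = (τ - σ) • t := by rw [sub_smul]; abel
  have hnorm : ‖(p + τ • t) - (p + σ • t)‖ ^ 2 = (τ - σ) ^ 2 := by
    rw [hdiff, norm_smul, Real.norm_eq_abs, ht, mul_one, sq_abs]
  have hinner : ⟪(p + τ • t) - (p + σ • t), Y τ - Y σ⟫_ℝ = 0 := by
    rw [hdiff, real_inner_smul_left, inner_sub_right, real_inner_comm (Y τ), real_inner_comm (Y σ), hYn, hYn]
    ring
  -- bilinearity / antisymmetry of the tree's `cross` (inlined; the named forms live in unrelated Theorems files)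
  have cross_self' : cross t t = 0 := by simp [cross]
  have cross_smul_right : ∀ (a b : EuclideanSpace ℝ (Fin 3)) (c : ℝ), cross a (c • b) = c • cross a b :=
    fun a b c => by rw [← crossCLM_apply, map_smul, crossCLM_apply]
  have cross_sub_right : ∀ (a b c : EuclideanSpace ℝ (Fin 3)), cross a (b - c) = cross a b - cross a c :=
    fun a b c => by rw [← crossCLM_apply, map_sub, crossCLM_apply, crossCLM_apply]
  have cross_anti : cross (deriv Y σ) t = -cross t (deriv Y σ) := by
    simp only [cross]
    rw [← neg_cross (WithLp.ofLp t) (WithLp.ofLp (deriv Y σ)), WithLp.toLp_neg]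
  rw [deriv_line, hinner, hnorm, hdiff]
  simp only [cross_smul_right, cross_self', cross_sub_right, cross_anti, mul_zero, zero_mul,
    smul_zero, zero_add, smul_neg]
  module

/-- **B1.** The self term of the linearised map on the straight constant-core model with a normal variation:
`∫ D_j σ dσ = ∫ ((τ−σ)²+q)^{-3/2} • t × (Y τ − Y σ − (τ−σ)•Y′σ) dσ`. [folklore] -/
theorem selfTerm_straight (p t : EuclideanSpace ℝ (Fin 3)) (ht : ‖t‖ = 1) (q : ℝ) (Y : ℝ → EuclideanSpace ℝ (Fin 3))
    (hYn : ∀ σ, ⟪Y σ, t⟫_ℝ = 0) (τ : ℝ) :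
    ∫ σ : ℝ, ((-3 * ⟪(p + τ • t) - (p + σ • t), Y τ - Y σ⟫_ℝ *
          ((‖(p + τ • t) - (p + σ • t)‖ ^ 2 + q) ^ (5 / 2 : ℝ))⁻¹) •
        cross (deriv (fun σ : ℝ => p + σ • t) σ) ((p + τ • t) - (p + σ • t)) +
      ((‖(p + τ • t) - (p + σ • t)‖ ^ 2 + q) ^ (3 / 2 : ℝ))⁻¹ •
        (cross (deriv (fun σ : ℝ => p + σ • t) σ) (Y τ - Y σ) + cross (deriv Y σ) ((p + τ • t) - (p + σ • t))))
    = ∫ σ : ℝ, (((τ - σ) ^ 2 + q) ^ (3 / 2 : ℝ))⁻¹ • cross t (Y τ - Y σ - (τ - σ) • deriv Y σ) :=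
  integral_congr_ae (Filter.Eventually.of_forall fun σ => selfIntegrand_straight p t ht q Y hYn τ σ)

end Summit.NavierStokesRegularity.NavierStokesRegularity.Theorems.MatchedKernel
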